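import Literature.AlgebraicGeometry.Frobenioids.ModelFrobenioidComparison
import HarnessLib

/-!
# Frobenioids I, Proposition 4.4 (iv) / Definition 1.3 (iii)(c): transport of `O^×(A^birat)` along
co-angular pre-steps

Mochizuki, *The geometry of Frobenioids I: the general theory*, Kyushu J. Math. **62** (2008)
293–400, §4 Proposition 4.4 (iv) p. 83 ("a morphism of `C` maps to an isomorphism of `C^birat` if
and only if it is a co-angular pre-step"), §1 Definition 1.3 (iii)(c) p. 24 (a co-angular pre-step
`φ : A → B` induces a bijection `O^▷(A) ⥲ O^▷(B)` with `β ∘ φ = φ ∘ α`) and §2 Proposition 2.2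
(ii)(b)
p. 45 (this bijection is the value of the functor `O^▷(−)` / `O^×(−)` on pre-steps)
[cite: MochizukiFrdI2008, Prop. 4.4(iv) p.83].

For a co-angular pre-step `ψ : A → A'` of a Frobenioid, `ψ` becomes invertible in `C^birat`, so
conjugation by `ψ` identifies `O^×(A^birat)` with `O^×(A'^birat)`.  On fractions this is
`(α, φ) ↦ (α ≫ ψ, φ ≫ ψ)`.  This file constructs that map `BiratUnits.push ψ : O^×(A^birat) →*
O^×(A'^birat)`,
proves it is a group ISOMORPHISM (`pushEquiv`; injective because `ψ` is a monomorphism, surjective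
by refining and factoring through `ψ` with Def. 1.3 (iii)(d)), that it is exactly the intertwining
relation "`ψ ∘ u = v ∘ ψ` in `C^birat`" of `BiratUnits.Intertwines` (`intertwines_iff_push_eq`), and
that it transports divisors along the base isomorphism `Base(ψ)` (`pullGp_divHom_push`); v2 follows
the
corrected `Intertwines` of `ModelFrobenioidComparison.lean` (right leg an arbitrary morphism), with
the
descent lemma `IsCoAngularPreStep.of_comp_right` recovering that it is a pre-step here.  This is
the
pre-step half of the functoriality of the rational function monoid (Prop. 2.2 (ii)(b)); the
pull-back
half (Prop. 2.2 (ii)(a), via Prop. 1.11 (iv)/(v)) is a separate file.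
-/

namespace Literature.AlgebraicGeometry.Frobenioids

open CategoryTheory Opposite

universe w v v' u u'

namespace PreFrobenioid

variable {D : Type u} [Category.{v} D] {Φ : Dᵒᵖ ⥤ CommMonCat.{w}}
  {C : Type u'} [Category.{v'} C] {F : C ⥤ ElemFrobenioid Φ}

/-! ### Co-angular pre-steps: descent along a pre-step -/

/-- If `l ≫ β` is a co-angular pre-step and `β` a pre-step, then `l` is a co-angular pre-step
(degrees multiply, `Base β` is an isomorphism, and a factorisation of `l` through an isometric
pre-step
extends by `β` to one of `l ≫ β`). [cite: MochizukiFrdI2008, Def. 1.2(iii)] -/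
theorem IsCoAngularPreStep.of_comp_right (hF : IsFrobenioid F) {X Y Z : C} {l : X ⟶ Y}
    {β : Y ⟶ Z}
    (hβ : IsPreStep F β) (h : IsCoAngularPreStep F (l ≫ β)) : IsCoAngularPreStep F l := by
  have hlin : IsLinear F l := by
    have h1 := h.2.1
    change degFr F (l ≫ β) = 1 at h1
    rw [degFr_comp, hβ.1, mul_one] at h1
    exact h1
  haveI : IsIso (Base F β) := hβ.2
  haveI : IsIso (Base F (l ≫ β)) := h.2.2
  have hbi : IsBaseIso F l := by
    change IsIso (Base F l)
    have : IsIso (Base F l ≫ Base F β) := by rw [← base_comp]; infer_instance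
    exact IsIso.of_isIso_comp_right (Base F l) (Base F β)
  refine ⟨fun X' Y' γ b a hfac ha hb₁ hb₂ hbase => ?_, hlin, hbi⟩
  have _ := hF
  refine h.1 γ b (a ≫ β) (by simp only [← Category.assoc, hfac]) ?_ hb₁ hb₂ ?_
  · change degFr F (a ≫ β) = 1
    rw [degFr_comp, ha, hβ.1, mul_one]
  · rcases hbase with ha' | hγ
    · left
      change IsIso (Base F (a ≫ β))
      rw [base_comp]
      haveI : IsIso (Base F a) := ha'
      infer_instance
    · exact Or.inr hγ

/-! ### Pull-back maps along base isomorphisms are bijective -/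

namespace RatFrac

/-- `Φ(b)` is bijective for an isomorphism `b` of `D` (inverse `Φ(b⁻¹)`).
[cite: MochizukiFrdI2008, Def. 1.1(ii)] -/
theorem pull_bijective_of_isIso {X Y : D} (b : X ⟶ Y) [IsIso b] :
    Function.Bijective (pull Φ b) := by
  constructor
  · intro x y hxy
    have := congrArg (pull Φ (CategoryTheory.inv b)) hxy
    rwa [← pull_comp, ← pull_comp, IsIso.inv_hom_id, pull_id, pull_id] at this
  · intro y
    exact ⟨pull Φ (CategoryTheory.inv b) y, by rw [← pull_comp, IsIso.hom_inv_id, pull_id]⟩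

/-- Divisibility is reflected by `Φ(b)` for an isomorphism `b` of `D`. [cite: MochizukiFrdI2008,
Def. 1.1(ii)] -/
theorem dvd_of_pull_dvd {X Y : D} (b : X ⟶ Y) [IsIso b] {x y : Φ.obj (op Y)}
    (h : pull Φ b x ∣ pull Φ b y) : x ∣ y := by
  obtain ⟨c, hc⟩ := h
  obtain ⟨c', rfl⟩ := (pull_bijective_of_isIso b).2 c
  rw [← map_mul] at hc
  exact ⟨c', (pull_bijective_of_isIso b).1 hc⟩

variable {hF : IsFrobenioid F} {A A' : C}

variable (hF) in
/-- Pushing a fraction forward along a co-angular pre-step `ψ : A → A'`: `(α, φ) ↦ (α ≫ ψ, φ ≫ ψ)`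
(conjugation by the isomorphism `ψ` of `C^birat`, Prop. 4.4 (iv)). [cite: MochizukiFrdI2008, Prop.
4.4(iv) p.83] -/
def push (ψ : A ⟶ A') (hψ : IsCoAngularPreStep F ψ) (p : RatFrac F A) : RatFrac F A' where
  src := p.src
  den := p.den ≫ ψ
  num := p.num ≫ ψ
  den_mem := p.den_mem.comp hF hψ
  num_mem := p.num_mem.comp hF hψ
  baseEq := by
    change Base F (p.den ≫ ψ) = Base F (p.num ≫ ψ)
    rw [base_comp, base_comp, p.baseEq]

/-- Pushing forward respects refinement. [cite: MochizukiFrdI2008, Prop. 4.4(iv) p.83] -/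
theorem push_rel (ψ : A ⟶ A') (hψ : IsCoAngularPreStep F ψ) {p q : RatFrac F A} (h : Rel p q) :
    Rel (push hF ψ hψ p) (push hF ψ hψ q) := by
  obtain ⟨E, ε, ε', hε, hε', h₁, h₂⟩ := h
  refine ⟨E, ε, ε', hε, hε', ?_, ?_⟩
  · change ε ≫ p.den ≫ ψ = ε' ≫ q.den ≫ ψ
    rw [← Category.assoc, h₁, Category.assoc]
  · change ε ≫ p.num ≫ ψ = ε' ≫ q.num ≫ ψ
    rw [← Category.assoc, h₂, Category.assoc]

/-- Pushing forward reflects refinement (`ψ` is a monomorphism). [cite: MochizukiFrdI2008, Prop.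
4.4(iv) p.83] -/
theorem rel_of_push_rel (ψ : A ⟶ A') (hψ : IsCoAngularPreStep F ψ) {p q : RatFrac F A}
    (h : Rel (push hF ψ hψ p) (push hF ψ hψ q)) : Rel p q := by
  haveI : Mono ψ := hψ.mono hF
  obtain ⟨E, ε, ε', hε, hε', h₁, h₂⟩ := h
  refine ⟨E, ε, ε', hε, hε', ?_, ?_⟩
  · rw [← cancel_mono ψ, Category.assoc, Category.assoc]
    exact h₁
  · rw [← cancel_mono ψ, Category.assoc, Category.assoc]
    exact h₂

/-- A refinement datum for `(p, q)` is one for the pushed-forward fractions, and the products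
correspond. [cite: MochizukiFrdI2008, Prop. 4.4(iv) p.83] -/
theorem push_mul_rel (ψ : A ⟶ A') (hψ : IsCoAngularPreStep F ψ) (p q : RatFrac F A) :
    Rel (mul hF (push hF ψ hψ p) (push hF ψ hψ q)) (push hF ψ hψ (mul hF p q)) := by
  let R := someRefinement hF p q
  let R' : Refinement (push hF ψ hψ p) (push hF ψ hψ q) :=
    { apex := R.apex, left := R.left, right := R.right, left_mem := R.left_mem
      right_mem := R.right_mem
      w := by
        change R.left ≫ p.num ≫ ψ = R.right ≫ q.den ≫ ψ
        rw [← Category.assoc, R.w, Category.assoc] }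
  refine Rel.trans hF (mulWith_rel hF _ _ _ R') ?_
  refine ⟨R.apex, 𝟙 _, 𝟙 _, isCoAngularPreStep_id hF _, isCoAngularPreStep_id hF _, ?_, ?_⟩
  · change 𝟙 _ ≫ R.left ≫ p.den ≫ ψ = 𝟙 _ ≫ (R.left ≫ p.den) ≫ ψ
    rw [Category.assoc]
  · change 𝟙 _ ≫ R.right ≫ q.num ≫ ψ = 𝟙 _ ≫ (R.right ≫ q.num) ≫ ψ
    rw [Category.assoc]

/-- Every fraction at `A'` is, up to refinement, the push-forward of a fraction at `A` along the
co-angular pre-step `ψ : A → A'` (refine the denominator against `ψ`, deepen so that the numerator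
becomes divisible by `ψ`, and factor it through `ψ` by Def. 1.3 (iii)(d)).
[cite: MochizukiFrdI2008, Prop. 4.4(iv) p.83] -/
theorem exists_push_rel (ψ : A ⟶ A') (hψ : IsCoAngularPreStep F ψ) (q : RatFrac F A') :
    ∃ p : RatFrac F A, Rel (push hF ψ hψ p) q := by
  haveI : IsIso (Base F ψ) := hψ.2.2
  -- refine `β = q.den` against `ψ`
  obtain ⟨E, κ, μ, hκ, hμ, hsq⟩ := exists_common_refinement hF q.den ψ q.den_mem hψ
  -- deepen by a co-angular pre-step `ε` with `(ε^*)⁻¹ Div ε = μ^* Div ψ`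
  obtain ⟨E', ε, hε, hεdiv⟩ := hF.iii_d_over_surj E (pull Φ (Base F μ) (Div F ψ))
  have hεκ : IsCoAngularPreStep F (ε ≫ κ) := hε.comp hF hκ
  have hεκχ : IsCoAngularPreStep F ((ε ≫ κ) ≫ q.num) := hεκ.comp hF q.num_mem
  have hεμ : IsCoAngularPreStep F (ε ≫ μ) := hε.comp hF hμ
  -- base bookkeeping: `Base((εκ)χ) = Base(εμ) ≫ Base ψ`
  have hbase : Base F ((ε ≫ κ) ≫ q.num) = Base F (ε ≫ μ) ≫ Base F ψ := by
    rw [base_comp, ← q.baseEq, ← base_comp, Category.assoc, hsq, ← Category.assoc, base_comp]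
  -- divisibility `invDiv ψ ∣ invDiv ((εκ)χ)` in `Φ(A')`, checked after transport to `Φ(E')`
  have hdvd : invDiv F ψ hψ.2.2 ∣ invDiv F ((ε ≫ κ) ≫ q.num) hεκχ.2.2 := by
    haveI : IsIso (Base F ((ε ≫ κ) ≫ q.num)) := hεκχ.2.2
    apply dvd_of_pull_dvd (Base F ((ε ≫ κ) ≫ q.num))
    rw [pull_invDiv]
    have e1 : pull Φ (Base F ((ε ≫ κ) ≫ q.num)) (invDiv F ψ hψ.2.2) =
        pull Φ (Base F (ε ≫ μ)) (Div F ψ) := by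
      rw [hbase, pull_comp, pull_invDiv]
    rw [e1, div_comp, div_comp, show (degFr F q.num : ℕ) = 1 by rw [q.num_mem.2.1]; rfl,
      show (degFr F κ : ℕ) = 1 by rw [hκ.2.1]; rfl, pow_one, pow_one, base_comp, pull_comp,
      ← pull_invDiv ε hε.2.2, hεdiv, ← pull_comp]
    exact dvd_mul_of_dvd_right (dvd_mul_left _ _) _
  -- factor `(εκ)χ` through `ψ`
  obtain ⟨φ, hφ, hφψ⟩ := hF.iii_d_over_full ((ε ≫ κ) ≫ q.num) ψ hεκχ hψ hdvd
  -- the fraction `(εμ, φ)` at `A`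
  have hbq : BaseEquivalent F (ε ≫ μ) φ := by
    change Base F (ε ≫ μ) = Base F φ
    have h := congrArg (Base F) hφψ
    rw [base_comp, hbase] at h
    exact ((cancel_mono (Base F ψ)).mp h).symm
  refine ⟨⟨E', ε ≫ μ, φ, hεμ, hφ, hbq⟩, E', 𝟙 _, ε ≫ κ, isCoAngularPreStep_id hF _, hεκ, ?_, ?_⟩
  · change 𝟙 _ ≫ (ε ≫ μ) ≫ ψ = (ε ≫ κ) ≫ q.den
    rw [Category.id_comp, Category.assoc, ← hsq, Category.assoc]
  · change 𝟙 _ ≫ φ ≫ ψ = (ε ≫ κ) ≫ q.num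
    rw [Category.id_comp, hφψ]

/-- The divisor of a pushed-forward fraction is the transport of the divisor along `Base(ψ)`:
`ψ^* div(push p) = div p`. [cite: MochizukiFrdI2008, Prop. 4.4(i) p.84] -/
theorem pullGp_div_push (ψ : A ⟶ A') (hψ : IsCoAngularPreStep F ψ) (p : RatFrac F A) :
    pullGp Φ (Base F ψ) (div (push hF ψ hψ p)) = div p := by
  have hnum : pull Φ (Base F ψ) (invDiv F (p.num ≫ ψ) (push hF ψ hψ p).num_mem.2.2) =
      Div F ψ * invDiv F p.num p.num_mem.2.2 :=
    pull_invDiv_comp p.num ψ p.num_mem.2 hψ.2 _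
  have hden : pull Φ (Base F ψ) (invDiv F (p.den ≫ ψ) (push hF ψ hψ p).den_mem.2.2) =
      Div F ψ * invDiv F p.den p.den_mem.2.2 :=
    pull_invDiv_comp p.den ψ p.den_mem.2 hψ.2 _
  change pullGp Φ (Base F ψ) (Algebra.GrothendieckGroup.of _ / Algebra.GrothendieckGroup.of _) =
    Algebra.GrothendieckGroup.of _ / Algebra.GrothendieckGroup.of _
  rw [map_div, pullGp_of, pullGp_of]
  change Algebra.GrothendieckGroup.of (pull Φ (Base F ψ) (invDiv F (p.num ≫ ψ) _)) /
      Algebra.GrothendieckGroup.of (pull Φ (Base F ψ) (invDiv F (p.den ≫ ψ) _)) = _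
  rw [hnum, hden, map_mul, map_mul, mul_div_mul_left_eq_div]

end RatFrac

namespace BiratUnits

variable {hF : IsFrobenioid F} {A A' : C}

variable (hF) in
/-- **Transport along a co-angular pre-step** `ψ : A → A'`: conjugation by the isomorphism `ψ` of
`C^birat`, `O^×(A^birat) → O^×(A'^birat)`, `[(α, φ)] ↦ [(α ≫ ψ, φ ≫ ψ)]` — the value on the pre-step
`ψ` of the functor `O^×(−)` of Prop. 2.2 (ii)(b) (the bijection of Def. 1.3 (iii)(c), for
`C^birat`),
here as a group homomorphism. [cite: MochizukiFrdI2008, Prop. 2.2(ii) p.45] -/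
noncomputable def push (ψ : A ⟶ A') (hψ : IsCoAngularPreStep F ψ) :
    BiratUnits F hF A →* BiratUnits F hF A' where
  toFun := Quotient.map (RatFrac.push hF ψ hψ) fun _ _ h => RatFrac.push_rel ψ hψ h
  map_one' := by
    change mk hF (RatFrac.push hF ψ hψ (RatFrac.one hF A)) = mk hF (RatFrac.one hF A')
    apply sound
    refine ⟨A, 𝟙 A, ψ, isCoAngularPreStep_id hF A, hψ, ?_, ?_⟩
    · change 𝟙 A ≫ 𝟙 A ≫ ψ = ψ ≫ 𝟙 A'
      rw [Category.id_comp, Category.id_comp, Category.comp_id]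
    · change 𝟙 A ≫ 𝟙 A ≫ ψ = ψ ≫ 𝟙 A'
      rw [Category.id_comp, Category.id_comp, Category.comp_id]
  map_mul' x y := by
    obtain ⟨p, rfl⟩ := mk_surjective x
    obtain ⟨q, rfl⟩ := mk_surjective y
    change mk hF (RatFrac.push hF ψ hψ (RatFrac.mul hF q p)) =
      mk hF (RatFrac.mul hF (RatFrac.push hF ψ hψ q) (RatFrac.push hF ψ hψ p))
    exact (sound (RatFrac.push_mul_rel ψ hψ q p)).symm

/-- `push` on the class of a fraction. [cite: MochizukiFrdI2008, Prop. 4.4(iv) p.83] -/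
theorem push_mk (ψ : A ⟶ A') (hψ : IsCoAngularPreStep F ψ) (p : RatFrac F A) :
    push hF ψ hψ (mk hF p) = mk hF (RatFrac.push hF ψ hψ p) := rfl

/-- Transport along a co-angular pre-step is injective (`ψ` is a monomorphism).
[cite: MochizukiFrdI2008, Prop. 4.4(iv) p.83] -/
theorem push_injective (ψ : A ⟶ A') (hψ : IsCoAngularPreStep F ψ) :
    Function.Injective (push hF ψ hψ) := by
  intro x y hxy
  obtain ⟨p, rfl⟩ := mk_surjective x
  obtain ⟨q, rfl⟩ := mk_surjective y
  exact sound (RatFrac.rel_of_push_rel ψ hψ (mk_eq_mk_iff.mp hxy))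

/-- Transport along a co-angular pre-step is surjective. [cite: MochizukiFrdI2008, Prop. 4.4(iv)
p.83] -/
theorem push_surjective (ψ : A ⟶ A') (hψ : IsCoAngularPreStep F ψ) :
    Function.Surjective (push hF ψ hψ) := by
  intro y
  obtain ⟨q, rfl⟩ := mk_surjective y
  obtain ⟨p, hp⟩ := RatFrac.exists_push_rel (hF := hF) ψ hψ q
  exact ⟨mk hF p, sound hp⟩

variable (hF) in
/-- **Prop. 4.4 (iv) / Def. 1.3 (iii)(c) for `C^birat`**: a co-angular pre-step `ψ : A → A'`
induces a
group isomorphism `O^×(A^birat) ≃ O^×(A'^birat)` ("co-angular pre-step ↦ isomorphism of `C^birat`").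
[cite: MochizukiFrdI2008, Prop. 4.4(iv) p.83] -/
noncomputable def pushEquiv (ψ : A ⟶ A') (hψ : IsCoAngularPreStep F ψ) :
    BiratUnits F hF A ≃* BiratUnits F hF A' :=
  MulEquiv.ofBijective (push hF ψ hψ) ⟨push_injective ψ hψ, push_surjective ψ hψ⟩

/-- The intertwining relation "`ψ ∘ u = v ∘ ψ` in `C^birat`" along a co-angular pre-step `ψ` holds
exactly for `v = push ψ u` — so the naturality clause of `RationalFunctionMonoidStr` at pre-steps
says
that `B(Base ψ)` is the inverse of this conjugation (Prop. 2.2 (ii)(b)).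
[cite: MochizukiFrdI2008, Prop. 2.2(ii) p.45] -/
theorem intertwines_iff_push_eq (ψ : A ⟶ A') (hψ : IsCoAngularPreStep F ψ) (u : BiratUnits F hF A)
    (v : BiratUnits F hF A') : Intertwines hF ψ u v ↔ push hF ψ hψ u = v := by
  constructor
  · rintro ⟨p, q, E, κ, l, rfl, rfl, hκ, h₁, h₂⟩
    -- the right leg `l` is automatically a co-angular pre-step here (`ψ` being one)
    have hl : IsCoAngularPreStep F l :=
      IsCoAngularPreStep.of_comp_right hF q.den_mem.2
        (by rw [h₁, ← Category.assoc]; exact (hκ.comp hF p.den_mem).comp hF hψ)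
    rw [push_mk]
    apply sound
    refine ⟨E, κ, l, hκ, hl, ?_, ?_⟩
    · change κ ≫ p.den ≫ ψ = l ≫ q.den
      rw [h₁]
    · change κ ≫ p.num ≫ ψ = l ≫ q.num
      rw [h₂]
  · rintro rfl
    obtain ⟨p, rfl⟩ := mk_surjective u
    exact ⟨p, RatFrac.push hF ψ hψ p, p.src, 𝟙 _, 𝟙 _, rfl, rfl, isCoAngularPreStep_id hF _, rfl,
      rfl⟩

/-- Divisors are transported along `Base(ψ)`: `ψ^* Div(push ψ u) = Div(u)` in `Φ^gp`
(the 1-commutativity of `C^birat → F_{Φ^gp}` over `D`, Prop. 4.4 (i)). [cite: MochizukiFrdI2008,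
Prop. 4.4(i) p.83] -/
theorem pullGp_divHom_push (ψ : A ⟶ A') (hψ : IsCoAngularPreStep F ψ) (u : BiratUnits F hF A) :
    pullGp Φ (Base F ψ) (divHom hF A' (push hF ψ hψ u)) = divHom hF A u := by
  obtain ⟨p, rfl⟩ := mk_surjective u
  exact RatFrac.pullGp_div_push ψ hψ p

end BiratUnits

end PreFrobenioid

end Literature.AlgebraicGeometry.Frobenioids
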